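import Mathlib
import Summits.Ventures.PercRepro2.SwOutCrossBaseHull

/-!
# The cross base: the dual base and the blue hull formula (blind cell PercRepro2, night-4 g23,
2026-08-28; proofs/NIGHT4-G23.md §10, step (2))

The DUAL base keeps the colours of the class edges and flips every other edge (`dualCross`); it is
again a cross base (`CrossBase.dual`), and the blue colouring of a realisation is the realisation
of the dual base at the totally flipped point (`blue_crossReal`).  Hence the BLUE hull formula: at
a point without blue-side leak the blue cluster of `h` is `redSetX` of the flipped point
(**`cluster_blue_crossReal`**), and the hull of `h` lies in `{h, u}`, the arms and the dropped
vertices (`hull_crossReal_subset`).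
-/

namespace Summit.Ventures.PercRepro2

namespace CrossArm

open Hull LocRows

variable {V : Type*} {E : Type*}

open scoped Classical

section DualDefs

variable (ends : E → Sym2 V) (u : V) {ι X κ : Type*} (U : ι → Set V) (p : X → V)
  (G : SimpleGraph X) (F : κ → Set V)

/-- The edges of some class. -/
def classAllX : Set E :=
  {e | ∃ k, e ∈ touches ends (F k)} ∪ {e | ∃ j, e ∈ touches ends (U j)} ∪
    {e | ∃ i, e ∈ clsUPX ends u p i} ∪ {e | ∃ s, e ∈ clsCX ends p G s} ∪
    {e | ∃ i, e ∈ clsExtX ends u p i}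

/-- The dual base: the class edges keep their colour, every other edge is flipped. -/
noncomputable def dualCross (σ : Config E) : Config E :=
  fun e => if e ∈ classAllX ends u U p G F then σ e else !σ e

/-- The total flip of a point. -/
def flipXG (q : PtXG ι κ X G) : PtXG ι κ X G := (flipAll q.1, flipAll q.2.1, q.2.2.flip)

/-- The blue-side leak: the red-side leak of the flipped point. -/
def LeakBX (q : PtXG ι κ X G) : Prop := LeakRX G (flipXG G q)

end DualDefs

section Dual

variable {ends : E → Sym2 V} {σ : Config E} {h u : V} {ι X κ : Type*} {U : ι → Set V}
  {p : X → V} {G : SimpleGraph X} {F : κ → Set V} (hb : CrossBase ends σ h u U p G F)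
include hb

omit hb in
/-- The dual base on a class edge. -/
lemma dualCross_apply_of_mem {e : E} (he : e ∈ classAllX ends u U p G F) :
    dualCross ends u U p G F σ e = σ e := by
  simp [dualCross, he]

omit hb in
/-- The dual base off the classes. -/
lemma dualCross_apply_of_notMem {e : E} (he : e ∉ classAllX ends u U p G F) :
    dualCross ends u U p G F σ e = !σ e := by
  simp [dualCross, he]

/-- An edge at `h` is a class edge. -/
lemma CrossBase.h_edge_mem_classAllX {e : E} {x : V} (he : ends e = s(h, x)) :
    e ∈ classAllX ends u U p G F := by
  rcases hb.h_edges e x he with ⟨j, hj⟩ | ⟨k, hk⟩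
  · exact Or.inl (Or.inl (Or.inl (Or.inr ⟨j, x, hj, h, ends_swap he⟩)))
  · exact Or.inl (Or.inl (Or.inl (Or.inl ⟨k, x, hk, h, ends_swap he⟩)))

/-- An edge at `u` is a class edge. -/
lemma CrossBase.u_edge_mem_classAllX {e : E} {x : V} (he : ends e = s(u, x)) :
    e ∈ classAllX ends u U p G F := by
  rcases hb.u_edges e x he with ⟨j, hj⟩ | ⟨i, rfl⟩
  · exact Or.inl (Or.inl (Or.inl (Or.inr ⟨j, x, hj, u, ends_swap he⟩)))
  · exact Or.inl (Or.inl (Or.inr ⟨i, he⟩))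

/-- An edge at a dropped vertex is a class edge. -/
lemma CrossBase.p_edge_mem_classAllX {i : X} {e : E} {x : V} (he : ends e = s(p i, x)) :
    e ∈ classAllX ends u U p G F := by
  rcases hb.p_edges i e x he with rfl | ⟨j, rfl, hadj⟩ | ⟨_, hxu, hxp, _⟩
  · exact Or.inl (Or.inl (Or.inr ⟨i, ends_swap he⟩))
  · exact Or.inl (Or.inr ⟨⟨s(i, j), G.mem_edgeSet.2 hadj⟩, i, j, rfl, he⟩)
  · exact Or.inr ⟨i, x, he, hxu, hxp⟩

omit hb in
/-- An edge with an end in an arm is a class edge. -/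
lemma CrossBase.arm_edge_mem_classAllX {e : E} {x y : V} (he : ends e = s(x, y))
    (hx : x ∈ armsAllX U F) : e ∈ classAllX ends u U p G F := by
  rcases hx with hx | hx
  · obtain ⟨j, hj⟩ := Set.mem_iUnion.1 hx
    exact Or.inl (Or.inl (Or.inl (Or.inr ⟨j, x, hj, y, he⟩)))
  · obtain ⟨k, hk⟩ := Set.mem_iUnion.1 hx
    exact Or.inl (Or.inl (Or.inl (Or.inl ⟨k, x, hk, y, he⟩)))

/-- The dual base agrees with the base inside `S ∪ {h}` for an arm `S`. -/
lemma CrossBase.insideConfig_dualCross (S : Set V) (hS : S ⊆ armsAllX U F) :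
    insideConfig ends (S ∪ {h}) (dualCross ends u U p G F σ) =
      insideConfig ends (S ∪ {h}) σ := by
  funext e
  simp only [insideConfig]
  by_cases hw : e ∈ within ends (S ∪ {h})
  · obtain ⟨x, hx, y, hy, hxy⟩ := hw
    have hc : e ∈ classAllX ends u U p G F := by
      rcases hx with hx | hx
      · exact CrossBase.arm_edge_mem_classAllX hxy (hS hx)
      · rw [Set.mem_singleton_iff] at hx
        subst hx
        exact hb.h_edge_mem_classAllX hxy
    rw [dualCross_apply_of_mem hc]
  · rw [decide_eq_false hw]
    simp

/-- **The dual base is a cross base.** -/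
theorem CrossBase.dual : CrossBase ends (dualCross ends u U p G F σ) h u U p G F where
  hne_hu := hb.hne_hu
  hne_hp := hb.hne_hp
  hne_up := hb.hne_up
  p_inj := hb.p_inj
  h_notMem_U := hb.h_notMem_U
  u_notMem_U := hb.u_notMem_U
  p_notMem_U := hb.p_notMem_U
  h_notMem_F := hb.h_notMem_F
  u_notMem_F := hb.u_notMem_F
  p_notMem_F := hb.p_notMem_F
  U_disj := hb.U_disj
  U_disj_F := hb.U_disj_F
  F_disj := hb.F_disj
  U_nonempty := hb.U_nonempty
  F_nonempty := hb.F_nonempty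
  no_cross_UU := hb.no_cross_UU
  no_cross_UF := hb.no_cross_UF
  no_cross_FF := hb.no_cross_FF
  h_edges := hb.h_edges
  u_edges := hb.u_edges
  p_edges := hb.p_edges
  u_adj_U := hb.u_adj_U
  h_red := fun e x he => by
    rw [dualCross_apply_of_mem (hb.h_edge_mem_classAllX he)]
    exact hb.h_red e x he
  u_red := fun e x he => by
    rw [dualCross_apply_of_mem (hb.u_edge_mem_classAllX he)]
    exact hb.u_red e x he
  cross_red := fun i j e he => by
    rw [dualCross_apply_of_mem (hb.p_edge_mem_classAllX he)]
    exact hb.cross_red i j e he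
  ext_blue := fun i e x he hxu hxp => by
    rw [dualCross_apply_of_mem (hb.p_edge_mem_classAllX he)]
    exact hb.ext_blue i e x he hxu hxp
  bdry_blue := fun e x y he hx hyh hyu hyp hy => by
    rw [dualCross_apply_of_mem (CrossBase.arm_edge_mem_classAllX he hx)]
    exact hb.bdry_blue e x y he hx hyh hyu hyp hy
  U_conn := fun j x hx => by
    rw [hb.insideConfig_dualCross (U j) (fun y hy => Or.inl (Set.mem_iUnion.2 ⟨j, hy⟩))]
    exact hb.U_conn j x hx
  F_conn := fun k x hx => by
    rw [hb.insideConfig_dualCross (F k) (fun y hy => Or.inr (Set.mem_iUnion.2 ⟨k, hy⟩))]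
    exact hb.F_conn k x hx

omit hb in
/-- The realisation off the classes. -/
lemma CrossBase.crossReal_apply_none {q : PtXG ι κ X G} {e : E}
    (hF : ∀ k, e ∉ touches ends (F k)) (hU : ∀ j, e ∉ touches ends (U j))
    (hUP : ∀ i, e ∉ clsUPX ends u p i) (hC : ∀ s, e ∉ clsCX ends p G s)
    (hX : ∀ i, e ∉ clsExtX ends u p i) : crossReal ends u U p G F σ q e = σ e := by
  unfold crossReal
  rw [if_neg]
  rintro ((((⟨k, _, he⟩ | ⟨j, _, he⟩) | ⟨i, _, he⟩) | ⟨s, _, he⟩) | ⟨i, _, he⟩)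
  · exact hF k he
  · exact hU j he
  · exact hUP i he
  · exact hC s he
  · exact hX i he

/-- **The blue colouring of a realisation is the realisation of the dual base at the flipped
point.** -/
theorem CrossBase.blue_crossReal (q : PtXG ι κ X G) :
    blue (crossReal ends u U p G F σ q) =
      crossReal ends u U p G F (dualCross ends u U p G F σ) (flipXG G q) := by
  funext e
  simp only [blue]
  by_cases hF : ∃ k, e ∈ touches ends (F k)
  · obtain ⟨k, hk⟩ := hF
    rw [hb.crossReal_apply_F hk, hb.dual.crossReal_apply_F hk,
      dualCross_apply_of_mem (Or.inl (Or.inl (Or.inl (Or.inl ⟨k, hk⟩))))]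
    simp only [flipXG, flipAll]
    by_cases hk' : q.1 k = true <;> simp [hk']
  by_cases hU : ∃ j, e ∈ touches ends (U j)
  · obtain ⟨j, hj⟩ := hU
    rw [hb.crossReal_apply_U hj, hb.dual.crossReal_apply_U hj,
      dualCross_apply_of_mem (Or.inl (Or.inl (Or.inl (Or.inr ⟨j, hj⟩))))]
    simp only [flipXG, flipAll]
    by_cases hj' : q.2.1 j = true <;> simp [hj']
  by_cases hUP : ∃ i, e ∈ clsUPX ends u p i
  · obtain ⟨i, hi⟩ := hUP
    rw [hb.crossReal_apply_UP hi, hb.dual.crossReal_apply_UP hi,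
      dualCross_apply_of_mem (Or.inl (Or.inl (Or.inr ⟨i, hi⟩)))]
    simp only [flipXG, FibKE.flip]
    by_cases hi' : q.2.2.1 i = true <;> simp [hi']
  by_cases hC : ∃ s, e ∈ clsCX ends p G s
  · obtain ⟨s, hs⟩ := hC
    rw [hb.crossReal_apply_C hs, hb.dual.crossReal_apply_C hs,
      dualCross_apply_of_mem (Or.inl (Or.inr ⟨s, hs⟩))]
    simp only [flipXG, FibKE.flip]
    by_cases hs' : q.2.2.2.1 s = true <;> simp [hs']
  by_cases hX : ∃ i, e ∈ clsExtX ends u p i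
  · obtain ⟨i, hi⟩ := hX
    rw [hb.crossReal_apply_Ext hi, hb.dual.crossReal_apply_Ext hi,
      dualCross_apply_of_mem (Or.inr ⟨i, hi⟩)]
    simp only [flipXG, FibKE.flip]
    by_cases hi' : q.2.2.2.2 i = true <;> simp [hi']
  · simp only [not_exists] at hF hU hUP hC hX
    have hc : e ∉ classAllX ends u U p G F := by
      rintro ((((⟨k, hk⟩ | ⟨j, hj⟩) | ⟨i, hi⟩) | ⟨s, hs⟩) | ⟨i, hi⟩)
      · exact hF k hk
      · exact hU j hj
      · exact hUP i hi
      · exact hC s hs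
      · exact hX i hi
    rw [CrossBase.crossReal_apply_none hF hU hUP hC hX, CrossBase.crossReal_apply_none hF hU hUP hC hX,
      dualCross_apply_of_notMem hc]

/-- **The blue hull formula**: at a point without blue-side leak, the blue cluster of `h` is
`redSetX` of the flipped point. -/
theorem CrossBase.cluster_blue_crossReal (hup : ∀ i, ∃ e, ends e = s(u, p i))
    (hcross : ∀ i j, G.Adj i j → ∃ e, ends e = s(p i, p j)) {q : PtXG ι κ X G}
    (hq : ¬ LeakBX G q) :
    cluster ends (blue (crossReal ends u U p G F σ q)) h = redSetX h u U p G F (flipXG G q) := by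
  rw [hb.blue_crossReal]
  exact hb.dual.cluster_crossReal hup hcross hq

omit hb in
/-- `redSetX` lies in `{h, u}` with the dropped vertices and the arms. -/
lemma redSetX_subset {q : PtXG ι κ X G} {x : V} (hx : x ∈ redSetX h u U p G F q) :
    x = h ∨ x = u ∨ (∃ i, x = p i) ∨ x ∈ armsAllX U F := by
  rw [mem_redSetX_iff] at hx
  rcases hx with hx | ⟨j, -, hx⟩ | ⟨hx, -⟩ | ⟨i, hx, -, -⟩ | ⟨k, -, hx⟩
  · exact Or.inl hx
  · exact Or.inr (Or.inr (Or.inr (Or.inl (Set.mem_iUnion.2 ⟨j, hx⟩))))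
  · exact Or.inr (Or.inl hx)
  · exact Or.inr (Or.inr (Or.inl ⟨i, hx⟩))
  · exact Or.inr (Or.inr (Or.inr (Or.inr (Set.mem_iUnion.2 ⟨k, hx⟩))))

/-- **The hull of `h` stays inside the structure** at a point without leak. -/
theorem CrossBase.hull_crossReal_subset (hup : ∀ i, ∃ e, ends e = s(u, p i))
    (hcross : ∀ i j, G.Adj i j → ∃ e, ends e = s(p i, p j)) {q : PtXG ι κ X G}
    (hqR : ¬ LeakRX G q) (hqB : ¬ LeakBX G q) {x : V}
    (hx : x ∈ hull ends (crossReal ends u U p G F σ q) h) :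
    x = h ∨ x = u ∨ (∃ i, x = p i) ∨ x ∈ armsAllX U F := by
  rcases hx with hx | hx
  · rw [hb.cluster_crossReal hup hcross hqR] at hx
    exact redSetX_subset hx
  · rw [hb.cluster_blue_crossReal hup hcross hqB] at hx
    exact redSetX_subset hx

end Dual

end CrossArm

end Summit.Ventures.PercRepro2
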